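import Summits.Ventures.LatticeQCDFlow.Scaling.SwapAcceptanceLaw
import Summits.Ventures.LatticeQCDFlow.Exactness.PTBCSwap

/-!
HONEST FRAMING: exact (Metropolis-corrected) sampling algorithms for lattice gauge theory; figures
of merit are autocorrelation/cost numbers at stated couplings and volumes; no continuum-physics
claim.

# SwapAcceptanceLadder — `exp(−(δ√(2M) + Mδ²)) ≤ swapAcc ≤ exp(−mδ²/4)` UNDER A VARIANCE FLOOR `m` /
# CEILING `M`, AND THE REPLICA-LADDER COUNT LAW: `Θ((b − a)·√variance)` REPLICAS FOR `O(1)` ADJACENT SWAP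
# RATES (lean-2 GEN-11, ours; part 2 of 2, sequel of `SwapAcceptanceLaw`)

Venture-side (OURS).  Cell `lqcd-flow` (pub-lqcd), unit `pub-lqcd-lean-2-g11`, 2026-08-23.  Setting of
`SwapAcceptanceLaw`: `μ` a probability measure, `X` bounded measurable, `μ_u = μ.tilted(u·X)`, `ψ = cgf X μ`,
`ψ″(u) = Var_{μ_u}(X)`; `swapAcc X μ s t` the stationary mean replica-exchange / independence-Metropolis
acceptance between the parameters `s` and `t`.

* §0 two calculus lemmas: the midpoint gap `φ(s) + φ(t) − 2φ((s+t)/2)` of a `C²` function is `≥ m(t−s)²/4`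
  under `φ″ ≥ m` on `[s,t]` and `≤ M(t−s)²/4` under `φ″ ≤ M` (`midpoint_gap_ge_of_deriv2_ge`, `…_le_of_deriv2_le`);
  and the EXACTNESS DOCK `swapIntegrand_eq_involAccept`: the integrand `min(1, e^{(t−s)(X x − X y)})` of
  `swapAcc` is literally the Metropolis acceptance `involAccept` of the cell's T-REX / PTBC swap
  (`Exactness/PTBCSwap.lean`) for the actions `S₁ = −s·X`, `S₂ = −t·X`, whose product Boltzmann measure
  `∝ μ_s ⊗ μ_t` the swap leaves invariant (`Exactness.ptbcSwap_invariant`) — the functional is the mean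
  acceptance of an EXACT move.
* §1 **VARIANCE FLOOR / CEILING FORMS** (`s ≤ t`, `δ = t − s`): if `m ≤ Var_{μ_u}(X)` on `[s,t]` then
  `swapAcc ≤ exp(−m δ²/4)`; if `Var_{μ_u}(X) ≤ M` on `[s,t]` then `swapAcc ≥ exp(−(δ√(2M) + Mδ²))` (the mean
  drift `|ψ′(t) − ψ′(s)| ≤ Mδ` by the mean value theorem) (`swapAcc_le_exp_neg_floor`,
  `swapAcc_ge_exp_neg_ceiling`).  READING: the swap / IMH acceptance between neighbouring parameters is `O(1)`
  iff `δ = Θ(1/√Var)`.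
* §2 **REPLICA-LADDER COUNT LAW**: NECESSITY (`ladder_necessary`) — a monotone ladder `β_0 ≤ … ≤ β_K` with a
  variance floor `m ≥ 0` on `[β_0, β_K]` and every adjacent swap acceptance `≥ α > 0` has
  `m (β_K − β_0)² ≤ 4K² log(1/α)`, i.e. `K ≥ (β_K − β_0)·√m / (2√(log 1/α))`; SUFFICIENCY
  (`ladder_sufficient`, `ladder_sufficient'`) — under a ceiling `M` on `[a, a + Kδ]` the uniform ladder with
  `δ√M ≤ 1` and `3δ√M ≤ log(1/α)` has every adjacent acceptance `≥ α`: `K = ⌈(b−a)√M·max(1, 3/log(1/α))⌉`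
  replicas suffice.  Both sides: `Θ((b − a)·√(variance scale))` replicas.

Docking: `TrivializingMaps/CouplingLadderLawAnyGroup` (Wilson coupling family, every compact gauge group; the
tree's variance floors / ceiling give `Θ((b−a)√#plaq)` tempering replicas).  Literature grade (cell rule):
KNOWN MECHANISM (the `√N`/`√C_V` replica-spacing rule of parallel tempering: Hukushima–Nemoto 1996, Kofke 2002,
Predescu–Predescu–Ciobanu 2004; Katzgraber arXiv:0905.1629 p. 21), NEW TYPING with rigorous two-sided constants
for an arbitrary bounded exponential family; nothing cited as a fact.  NOT CLAIMED: round-trip / mixing times;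
optimal non-uniform ladders; anything finite-sample.
-/

noncomputable section

open MeasureTheory ProbabilityTheory Real Set Filter Topology

namespace Summit.Ventures.LatticeQCDFlow.Scaling

/-! ## §0 Two calculus lemmas: the midpoint gap of a function with a second-derivative floor / ceiling -/

section Calculus

/-- **Midpoint convexity gap under a second-derivative floor**: if `φ″ ≥ m` on `[s,t]` then
`φ(s) + φ(t) − 2φ((s+t)/2) ≥ m (t−s)²/4` (`φ − m u²/2` is convex on `[s,t]`). [folklore] -/
theorem midpoint_gap_ge_of_deriv2_ge {φ φ' φ'' : ℝ → ℝ} (hφ : ∀ u, HasDerivAt φ (φ' u) u)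
    (hφ' : ∀ u, HasDerivAt φ' (φ'' u) u) {s t m : ℝ} (hst : s ≤ t)
    (hm : ∀ u ∈ Icc s t, m ≤ φ'' u) :
    m * (t - s) ^ 2 / 4 ≤ φ s + φ t - 2 * φ ((s + t) / 2) := by
  set g : ℝ → ℝ := fun u => φ u - m / 2 * u ^ 2 with hg
  have hg1 : ∀ u, HasDerivAt g (φ' u - m / 2 * (2 * u)) u := fun u => by
    have h2 : HasDerivAt (fun u : ℝ => m / 2 * u ^ 2) (m / 2 * (2 * u)) u := by
      simpa using ((hasDerivAt_pow 2 u).const_mul (m / 2))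
    exact (hφ u).sub h2
  have hdg : deriv g = fun u => φ' u - m / 2 * (2 * u) := funext fun u => (hg1 u).deriv
  have hg2 : ∀ u, HasDerivAt (fun u => φ' u - m / 2 * (2 * u)) (φ'' u - m / 2 * 2) u := fun u => by
    have h2 : HasDerivAt (fun u : ℝ => m / 2 * (2 * u)) (m / 2 * 2) u := by
      simpa using (((hasDerivAt_id u).const_mul 2).const_mul (m / 2))
    exact (hφ' u).sub h2
  have hddg : deriv (deriv g) = fun u => φ'' u - m / 2 * 2 := by
    rw [hdg]; exact funext fun u => (hg2 u).deriv
  have hconv : ConvexOn ℝ (Icc s t) g := by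
    refine convexOn_of_deriv2_nonneg' (convex_Icc s t) (fun u _ => (hg1 u).differentiableAt.differentiableWithinAt)
      (fun u _ => ?_) (fun u hu => ?_)
    · rw [hdg]; exact (hg2 u).differentiableAt.differentiableWithinAt
    · simp only [Function.iterate_succ, Function.iterate_zero, Function.comp_apply, Function.id_def]
      rw [hddg]
      have := hm u hu
      linarith
  have hmid := hconv.2 (left_mem_Icc.2 hst) (right_mem_Icc.2 hst) (show (0 : ℝ) ≤ 1 / 2 by norm_num)
    (show (0 : ℝ) ≤ 1 / 2 by norm_num) (show (1 / 2 : ℝ) + 1 / 2 = 1 by norm_num)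
  simp only [smul_eq_mul, hg] at hmid
  have hm' : (1 / 2 : ℝ) * s + 1 / 2 * t = (s + t) / 2 := by ring
  rw [hm'] at hmid
  have key : m / 2 * s ^ 2 / 2 + m / 2 * t ^ 2 / 2 - m / 2 * ((s + t) / 2) ^ 2 = m * (t - s) ^ 2 / 4 / 2 := by
    ring
  nlinarith [hmid, key]

/-- **Midpoint gap under a second-derivative ceiling**: if `φ″ ≤ M` on `[s,t]` then
`φ(s) + φ(t) − 2φ((s+t)/2) ≤ M (t−s)²/4`. [folklore] -/
theorem midpoint_gap_le_of_deriv2_le {φ φ' φ'' : ℝ → ℝ} (hφ : ∀ u, HasDerivAt φ (φ' u) u)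
    (hφ' : ∀ u, HasDerivAt φ' (φ'' u) u) {s t M : ℝ} (hst : s ≤ t)
    (hM : ∀ u ∈ Icc s t, φ'' u ≤ M) :
    φ s + φ t - 2 * φ ((s + t) / 2) ≤ M * (t - s) ^ 2 / 4 := by
  have h := midpoint_gap_ge_of_deriv2_ge (φ := fun u => -φ u) (φ' := fun u => -φ' u)
    (φ'' := fun u => -φ'' u) (fun u => (hφ u).neg) (fun u => (hφ' u).neg) (m := -M) hst
    (fun u hu => neg_le_neg (hM u hu))
  linarith

end Calculus

/-! ## §0b Dock to the cell's exactness anchor -/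

section Dock

variable {Ω : Type*} [MeasurableSpace Ω] {X : Ω → ℝ}

/-- **EXACTNESS DOCK**: the integrand of `swapAcc X μ s t` at `(x, y)` is the Metropolis acceptance
`involAccept (S₁ ⊕ S₂) (trexSwap id) (x, y) = min(1, e^{−(S₁ y + S₂ x − S₁ x − S₂ y)})` of the replica swap of
`Exactness/PTBCSwap.lean` for the actions `S₁ = −s·X`, `S₂ = −t·X` (reference measure `μ` per replica); that
swap leaves `e^{−S₁(x)−S₂(y)} μ⊗μ ∝ μ_s ⊗ μ_t` invariant (`Exactness.ptbcSwap_invariant`). [ours] -/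
theorem swapIntegrand_eq_involAccept (s t : ℝ) (x y : Ω) :
    min 1 (Real.exp ((t - s) * (X x - X y))) =
      Exactness.involAccept (fun z : Ω × Ω => -(s * X z.1) + -(t * X z.2))
        (Exactness.trexSwap (MeasurableEquiv.refl Ω)) (x, y) := by
  simp only [Exactness.involAccept, Exactness.trexSwap_refl_apply, Prod.swap_prod_mk]
  congr 1
  congr 1
  ring

end Dock

/-! ## §1 Variance floor / ceiling forms -/

section FloorCeiling

variable {Ω : Type*} [MeasurableSpace Ω] {μ : Measure Ω} [IsProbabilityMeasure μ] {X : Ω → ℝ}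

/-- **UNDER A VARIANCE FLOOR the acceptance is exponentially small in `m δ²`:** if `s ≤ t` and
`m ≤ Var_{μ_u}(X)` for `u ∈ [s,t]`, then `swapAcc X μ s t ≤ exp(−m (t−s)²/4)`. [ours] -/
theorem swapAcc_le_exp_neg_floor (hXm : Measurable X) (hXb : ∃ C, ∀ ω, |X ω| ≤ C) {s t m : ℝ}
    (hst : s ≤ t) (hm : ∀ u ∈ Icc s t, m ≤ variance X (μ.tilted fun ω => u * X ω)) :
    swapAcc X μ s t ≤ exp (-(m * (t - s) ^ 2 / 4)) := by
  refine (swapAcc_le_exp_midpoint_gap hXm hXb s t).trans (exp_le_exp.2 ?_)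
  have h := midpoint_gap_ge_of_deriv2_ge (hasDerivAt_cgf_of_bounded (μ := μ) hXm hXb)
    (hasDerivAt_deriv_cgf_of_bounded (μ := μ) hXm hXb) hst hm
  linarith

/-- **UNDER A VARIANCE CEILING the acceptance is at least `exp(−(δ√(2M) + Mδ²))`:** if `s ≤ t` and
`Var_{μ_u}(X) ≤ M` for `u ∈ [s,t]`, then `exp(−((t−s)√(2M) + M(t−s)²)) ≤ swapAcc X μ s t`
(`Var_s, Var_t ≤ M` and `|m_t − m_s| = |ψ′(t) − ψ′(s)| ≤ M(t−s)` by the mean value theorem). [ours] -/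
theorem swapAcc_ge_exp_neg_ceiling (hXm : Measurable X) (hXb : ∃ C, ∀ ω, |X ω| ≤ C) {s t M : ℝ}
    (hst : s ≤ t) (hM : ∀ u ∈ Icc s t, variance X (μ.tilted fun ω => u * X ω) ≤ M) :
    exp (-((t - s) * sqrt (2 * M) + M * (t - s) ^ 2)) ≤ swapAcc X μ s t := by
  have hM0 : 0 ≤ M := (variance_nonneg _ _).trans (hM s (left_mem_Icc.2 hst))
  refine le_trans (exp_le_exp.2 ?_) (swapAcc_ge_exp_neg hXm hXb s t)
  rw [neg_le_neg_iff, abs_of_nonneg (sub_nonneg.2 hst)]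
  have hδ : 0 ≤ t - s := sub_nonneg.2 hst
  -- the mean drift `|ψ′(s) − ψ′(t)| ≤ M (t − s)`
  have hdrift : |(∫ ω, X ω ∂(μ.tilted fun ω => s * X ω)) - ∫ ω, X ω ∂(μ.tilted fun ω => t * X ω)| ≤
      M * (t - s) := by
    rw [integral_tilted_eq_deriv_cgf hXm hXb, integral_tilted_eq_deriv_cgf hXm hXb]
    rcases eq_or_lt_of_le hst with h | h
    · subst h; simp
    · -- mean value theorem for `ψ′` on `[s,t]`
      have hψ'' := hasDerivAt_deriv_cgf_of_bounded (μ := μ) hXm hXb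
      obtain ⟨ξ, hξ, hslope⟩ := exists_hasDerivAt_eq_slope (deriv (cgf X μ))
        (fun u => variance X (μ.tilted fun ω => u * X ω)) h
        (fun u _ => (hψ'' u).continuousAt.continuousWithinAt) (fun u _ => hψ'' u)
      have hξ' : ξ ∈ Icc s t := Ioo_subset_Icc_self hξ
      have hv0 : 0 ≤ variance X (μ.tilted fun ω => ξ * X ω) := variance_nonneg _ _
      have hvM := hM ξ hξ'
      have heq : deriv (cgf X μ) t - deriv (cgf X μ) s =
          variance X (μ.tilted fun ω => ξ * X ω) * (t - s) := by
        rw [hslope, div_mul_cancel₀ _ (sub_ne_zero.2 (ne_of_gt h))]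
      rw [abs_sub_comm, abs_of_nonneg (by rw [heq]; positivity), heq]
      exact mul_le_mul_of_nonneg_right hvM hδ
  have hVs := hM s (left_mem_Icc.2 hst)
  have hVt := hM t (right_mem_Icc.2 hst)
  have hsq : ((∫ ω, X ω ∂(μ.tilted fun ω => s * X ω)) - ∫ ω, X ω ∂(μ.tilted fun ω => t * X ω)) ^ 2 ≤
      (M * (t - s)) ^ 2 := by
    rw [← sq_abs]; exact pow_le_pow_left₀ (abs_nonneg _) hdrift 2
  have hroot : sqrt (variance X (μ.tilted fun ω => s * X ω) + variance X (μ.tilted fun ω => t * X ω) +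
      ((∫ ω, X ω ∂(μ.tilted fun ω => s * X ω)) - ∫ ω, X ω ∂(μ.tilted fun ω => t * X ω)) ^ 2) ≤
      sqrt (2 * M) + M * (t - s) := by
    refine (sqrt_le_sqrt (by linarith : _ ≤ 2 * M + (M * (t - s)) ^ 2)).trans ?_
    rw [sqrt_le_left (by positivity)]
    nlinarith [sq_sqrt (by positivity : (0:ℝ) ≤ 2 * M), sqrt_nonneg (2 * M), mul_nonneg hM0 hδ]
  calc (t - s) * sqrt _ ≤ (t - s) * (sqrt (2 * M) + M * (t - s)) := mul_le_mul_of_nonneg_left hroot hδ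
    _ = (t - s) * sqrt (2 * M) + M * (t - s) ^ 2 := by ring

end FloorCeiling

/-! ## §2 The replica-ladder count law -/

section Ladder

variable {Ω : Type*} [MeasurableSpace Ω] {μ : Measure Ω} [IsProbabilityMeasure μ] {X : Ω → ℝ}

/-- **NECESSITY — `K ≥ (b − a)·√m/(2√(log 1/α))` replicas.**  A monotone ladder `β` with a variance floor
`m ≥ 0` on `[β_0, β_K]` and every adjacent swap acceptance `≥ α` (`0 < α`) satisfies
`m·(β_K − β_0)² ≤ 4K²·log(1/α)`. [ours] -/
theorem ladder_necessary (hXm : Measurable X) (hXb : ∃ C, ∀ ω, |X ω| ≤ C) {m : ℝ} (hm0 : 0 ≤ m)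
    (K : ℕ) (β : ℕ → ℝ) (hβ : Monotone β)
    (hfloor : ∀ u ∈ Icc (β 0) (β K), m ≤ variance X (μ.tilted fun ω => u * X ω))
    {α : ℝ} (hα : 0 < α) (hacc : ∀ j < K, α ≤ swapAcc X μ (β j) (β (j + 1))) :
    m * (β K - β 0) ^ 2 ≤ 4 * (K : ℝ) ^ 2 * log (1 / α) := by
  -- per-rung: `m δ_j² ≤ 4 log(1/α)`
  have hstep : ∀ j < K, m * (β (j + 1) - β j) ^ 2 ≤ 4 * log (1 / α) := by
    intro j hj
    have hsub : Icc (β j) (β (j + 1)) ⊆ Icc (β 0) (β K) :=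
      Icc_subset_Icc (hβ (Nat.zero_le j)) (hβ (Nat.succ_le_of_lt hj))
    have hA := (hacc j hj).trans (swapAcc_le_exp_neg_floor hXm hXb (hβ (Nat.le_succ j))
      fun u hu => hfloor u (hsub hu))
    have hlog := (log_le_iff_le_exp hα).2 hA
    rw [one_div, log_inv]
    linarith
  -- sum and Cauchy–Schwarz
  have hsum : ∑ j ∈ Finset.range K, (β (j + 1) - β j) = β K - β 0 := Finset.sum_range_sub β K
  have hcs : (∑ j ∈ Finset.range K, (β (j + 1) - β j)) ^ 2 ≤
      K * ∑ j ∈ Finset.range K, (β (j + 1) - β j) ^ 2 := by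
    have h := sq_sum_le_card_mul_sum_sq (s := Finset.range K) (f := fun j => β (j + 1) - β j)
    simpa [Finset.card_range] using h
  have hsumsq : m * ∑ j ∈ Finset.range K, (β (j + 1) - β j) ^ 2 ≤ K * (4 * log (1 / α)) := by
    rw [Finset.mul_sum]
    calc ∑ j ∈ Finset.range K, m * (β (j + 1) - β j) ^ 2
        ≤ ∑ _j ∈ Finset.range K, 4 * log (1 / α) :=
          Finset.sum_le_sum fun j hj => hstep j (Finset.mem_range.1 hj)
      _ = K * (4 * log (1 / α)) := by rw [Finset.sum_const, Finset.card_range, nsmul_eq_mul]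
  rw [← hsum]
  calc m * (∑ j ∈ Finset.range K, (β (j + 1) - β j)) ^ 2
      ≤ m * (K * ∑ j ∈ Finset.range K, (β (j + 1) - β j) ^ 2) := mul_le_mul_of_nonneg_left hcs hm0
    _ = K * (m * ∑ j ∈ Finset.range K, (β (j + 1) - β j) ^ 2) := by ring
    _ ≤ K * (K * (4 * log (1 / α))) := mul_le_mul_of_nonneg_left hsumsq (Nat.cast_nonneg K)
    _ = 4 * (K : ℝ) ^ 2 * log (1 / α) := by ring

/-- **SUFFICIENCY — the uniform ladder under a variance ceiling.**  If `Var_{μ_u}(X) ≤ M` on `[a, a+Kδ]`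
(`δ ≥ 0`) and `δ√(2M) + Mδ² ≤ log(1/α)`, every adjacent swap of the uniform ladder `a + jδ` (`j ≤ K`) is
accepted with probability `≥ α`. [ours] -/
theorem ladder_sufficient (hXm : Measurable X) (hXb : ∃ C, ∀ ω, |X ω| ≤ C) {a δ M α : ℝ}
    (hδ : 0 ≤ δ) {K : ℕ} (hM : ∀ u ∈ Icc a (a + K * δ), variance X (μ.tilted fun ω => u * X ω) ≤ M)
    (hcond : δ * sqrt (2 * M) + M * δ ^ 2 ≤ log (1 / α)) (hα : 0 < α) :
    ∀ j < K, α ≤ swapAcc X μ (a + j * δ) (a + (j + 1) * δ) := by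
  intro j hj
  have hst : a + j * δ ≤ a + (j + 1) * δ := by nlinarith
  have hsub : Icc (a + j * δ) (a + (j + 1) * δ) ⊆ Icc a (a + K * δ) := by
    refine Icc_subset_Icc (by nlinarith) ?_
    have : ((j : ℝ) + 1) ≤ K := by exact_mod_cast Nat.succ_le_of_lt hj
    nlinarith
  have h := swapAcc_ge_exp_neg_ceiling hXm hXb hst fun u hu => hM u (hsub hu)
  have hts : a + (j + 1) * δ - (a + j * δ) = δ := by ring
  rw [hts] at h
  refine le_trans ?_ h
  rw [← log_le_iff_le_exp hα]
  have : log α = -log (1 / α) := by rw [one_div, log_inv, neg_neg]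
  rw [this]
  linarith

/-- **SUFFICIENCY, clean form — `K = ⌈(b−a)·√M·max(1, 3/log(1/α))⌉` replicas suffice**: if
`δ√M ≤ 1` and `3·δ√M ≤ log(1/α)` then `δ√(2M) + Mδ² ≤ log(1/α)`, so `ladder_sufficient` applies. [ours] -/
theorem ladder_sufficient' (hXm : Measurable X) (hXb : ∃ C, ∀ ω, |X ω| ≤ C) {a δ M α : ℝ}
    (hδ : 0 ≤ δ) (hM0 : 0 ≤ M) {K : ℕ}
    (hM : ∀ u ∈ Icc a (a + K * δ), variance X (μ.tilted fun ω => u * X ω) ≤ M)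
    (hu1 : δ * sqrt M ≤ 1) (hu2 : 3 * (δ * sqrt M) ≤ log (1 / α)) (hα : 0 < α) :
    ∀ j < K, α ≤ swapAcc X μ (a + j * δ) (a + (j + 1) * δ) := by
  refine ladder_sufficient hXm hXb hδ hM ?_ hα
  have hu0 : 0 ≤ δ * sqrt M := mul_nonneg hδ (sqrt_nonneg M)
  have h2 : sqrt (2 * M) = sqrt 2 * sqrt M := sqrt_mul (by norm_num) M
  have hs2 : sqrt 2 ≤ 2 := by
    rw [sqrt_le_left (by norm_num)]; norm_num
  have hsq : M * δ ^ 2 = (δ * sqrt M) ^ 2 := by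
    rw [mul_pow, sq_sqrt hM0]; ring
  rw [h2, hsq]
  calc δ * (sqrt 2 * sqrt M) + (δ * sqrt M) ^ 2
      = sqrt 2 * (δ * sqrt M) + (δ * sqrt M) * (δ * sqrt M) := by ring
    _ ≤ 2 * (δ * sqrt M) + 1 * (δ * sqrt M) :=
        add_le_add (mul_le_mul_of_nonneg_right hs2 hu0) (mul_le_mul_of_nonneg_right hu1 hu0)
    _ = 3 * (δ * sqrt M) := by ring
    _ ≤ log (1 / α) := hu2

end Ladder

end Summit.Ventures.LatticeQCDFlow.Scaling

end
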